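import Summits.HodgeConjecture.HodgeConjecture.Theorems.VHCAbelianSchemesRoadRegimeDefs
import Literature.AlgebraicGeometry.HodgeTheory.HodgeTypeOfFlatSections
import Literature.AlgebraicGeometry.HodgeTheory.DivisorClassesFiniteEtaleBaseChange
import HarnessLib

/-!
# Road b02 (`VHCAbelianSchemesRoad`) — THE LEFSCHETZ SLACK OF K-SR♭∃ IS A SCALAR on every pencil with ONE fibre of Picard number one

research route conditional on HC_CM; not a corollary; Q11.4-sentence-2 already refuted in dim ≥ 3.

The route's «why it might fail» sentence for both cruxes (19779, 19274) — «on a generic-NS-rank-1 pencil flatness pins the Lefschetz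
correction to `c·Θᵖ` on fibres, so the carrier needs `κ_p = a·W|_s + c·θᵖ` EXACTLY» — made a KERNEL THEOREM, door-generic, on the
carriers and FACT-FREE. Setting: a smooth projective family `f : 𝒳 ⟶ S` over a smooth IRREDUCIBLE base (the binders of
`AdmissibleRepresentativesLefAt`), a global class `Θ ∈ H²(𝒳(ℂ); ℂ)` and ONE complex point `s♯` of the base at which every rational
`(1,1)`-class of `H²(𝒳_{s♯}(ℂ); ℂ)` lies on the line `ℂ · Θ|_{s♯}` (Picard number one IN HODGE FORM at `s♯`, e.g. a very general Weil-type
member; van Geemen 1994 Thm. 4.11 / §2.4).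

* §1 `divisorClassesSpan_le_span_cupPowTwo` — at such a fibre the complexified divisor ring in degree `2m` is the line `ℂ · (Θ|)ᵐ`
  (van Geemen's «`B¹(X) = ℚ` and thus `Dᵖ(X) = ℚ`», with the EXPLICIT generator; the Barriers file proves the `∃`-form).
* §2 **`exists_eq_smul_cupPowTwo_forall_of_mem_divisorClassesSpan_at` (THE PIN)** — a GLOBAL class `Z ∈ H^{2p}(𝒳)` whose restriction to
  `𝒳_{s♯}` is a Lefschetz class satisfies `Z|_s = c · (Θᵖ)|_s` for ONE scalar `c` and EVERY fibre `s` (identity principle for flat sections,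
  `complexBetti_map_fiberι_eq_zero_of_eq_zero_at`; `S(ℂ)` connected because `S` is irreducible). In particular a K-SR♭∃ correction `Z`
  (Lefschetz on EVERY fibre) is pinned by its value at `s♯` — at a split CM fibre, where the divisor span is large, the slack is STILL `c · θᵖ`.
* §3 **The pinned form of the K-SR♭∃ datum**: for every door `𝒪`, every datum `(s₁, I, κ, V, a, Z)` of the conclusion of
  `AdmissibleRepresentativesLefAt 𝒪` on such a pencil has `V_p|_s = a·W|_s + c·(Θᵖ)|_s` at EVERY fibre and `κ_p = a·W|_{s₁} + c·(Θᵖ)|_{s₁}`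
  (`pinned_of_lefAtDatum`); hence `AdmissibleRepresentativesLefAt 𝒪` / `LefAtExceptionalRegime 𝒪` deliver, on pencils with a Picard-rank-one
  fibre, a PINNED datum (`exists_pinned_of_admissibleRepresentativesLefAt`, `exists_pinned_of_lefAtExceptionalRegime`).
* §4 Conversely a pinned datum with `Θ|_s` rational `(1,1)` and `(Θᵖ)|_s` algebraic on every fibre IS a K-SR♭∃ datum (`Z := c · Θᵖ`;
  `cupPowTwo_map_mem_divisorClassesSpan`): on such pencils K-SR♭∃ is EXACTLY the design problem «an `𝒪`-admissible datum at some fibre with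
  `κ_p = a·W| + c·θᵖ`, `a ≠ 0`».

Nothing is asserted; `HC_CM` occurs nowhere; K-SR♭∃ and the regimes stay OPEN. References: [cite: vanGeemen1994HodgeAV, §2.4 and Thm. 4.11]
[cite: DeligneHodgeII1971, Cor. 4.1.2 (proof)] [cite: VoisinHodgeII2003, Lemma 4.17] [cite: Bloch1972Semiregularity, Remark (7.5)]
[cite: SGA1, Exp. XII Prop. 2.4].
-/

noncomputable section

open CategoryTheory CategoryTheory.Limits AlgebraicGeometry Topology

-- the cell's namespace repeats the summit name (`Summit.HodgeConjecture.HodgeConjecture…`), as in every `Ring2*` file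
set_option linter.dupNamespace false

namespace Summit.HodgeConjecture.HodgeConjecture.Ring2.SemiregularRepresentatives

open Literature.AlgebraicGeometry Literature.AlgebraicGeometry.Motives
open Literature.AlgebraicGeometry.HodgeTheory
open Literature.AlgebraicTopology.SingularHomology
open Literature.Barriers.HodgeConjecture (divisorClassesSpan divisorMonomials mem_divisorMonomials_zero mem_divisorMonomials_succ)
open Summit.Ventures.HSemireg (ObjClass)

/-! ## §1 Picard number one in Hodge form: the divisor ring is the line through the powers of `Θ|` -/

/-- **`B¹(X) = ℚ·E ⟹ Dᵐ(X) ⊗ ℂ = ℂ·Eᵐ`, with the explicit generator**: if every rational `(1,1)`-class of `H²(X(ℂ); ℂ)` lies on the line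
`ℂ · E`, the complexified divisor ring in degree `2m` lies on the line through the `m`-th cup power of `E` (induction on `m`, bilinearity of
the cup product; the Barriers file's `divisorClassesSpan_le_span_singleton` with the generator named). [cite: vanGeemen1994HodgeAV, Thm. 4.11 and §2.4]
[cite: HatcherAT2002, §3.2] -/
theorem divisorClassesSpan_le_span_cupPowTwo {X : SchemeOver ℂ} {N : ℕ} {E : complexBetti X 2}
    (hE : ∀ b : complexBetti X 2, IsRationalClass b → IsOfHodgeType N X 2 1 1 b → b ∈ ℂ ∙ E) :
    ∀ m : ℕ, divisorClassesSpan X N m ≤ ℂ ∙ cupPowTwo E m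
  | 0 => by
    refine Submodule.span_le.2 fun c hc ↦ ?_
    rw [SetLike.mem_coe, mem_divisorMonomials_zero.1 hc]
    exact Submodule.mem_span_singleton_self _
  | m + 1 => by
    refine Submodule.span_le.2 fun c hc ↦ ?_
    obtain ⟨a, ha, b, hb, hb', rfl⟩ := mem_divisorMonomials_succ.1 hc
    obtain ⟨s, rfl⟩ := Submodule.mem_span_singleton.1
      (divisorClassesSpan_le_span_cupPowTwo hE m (Submodule.subset_span ha))
    obtain ⟨t, rfl⟩ := Submodule.mem_span_singleton.1 (hE b hb hb')
    rw [SetLike.mem_coe, cupPowTwo_succ]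
    simp only [map_smul, LinearMap.smul_apply, smul_smul]
    exact Submodule.smul_mem _ _ (Submodule.mem_span_singleton_self _)

/-- **Powers of a restricted rational `(1,1)`-class are Lefschetz classes**: if `Θ|_X` is rational of type `(1,1)` then `(Θ|)ᵐ` is a divisor
monomial of degree `m`, so `c · (Θᵐ)|` lies in `Dᵐ ⊗ ℂ`. [cite: vanGeemen1994HodgeAV, §2.4] [cite: HatcherAT2002, §3.2] -/
theorem cupPowTwo_mem_divisorMonomials {X : SchemeOver ℂ} {N : ℕ} {E : complexBetti X 2} (hEQ : IsRationalClass E)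
    (hE : IsOfHodgeType N X 2 1 1 E) : ∀ m : ℕ, cupPowTwo E m ∈ divisorMonomials X N m
  | 0 => mem_divisorMonomials_zero.2 rfl
  | m + 1 => mem_divisorMonomials_succ.2 ⟨_, cupPowTwo_mem_divisorMonomials hEQ hE m, E, hEQ, hE, rfl⟩

variable {n : ℕ} {𝒳 S : SchemeOver ℂ} {f : 𝒳 ⟶ S}

/-- The restriction of `c · Θᵐ` to a fibre on which `Θ` is rational of type `(1,1)` is a Lefschetz class (`f^*(Θᵐ) = (f^*Θ)ᵐ`).
[cite: vanGeemen1994HodgeAV, §2.4] [cite: HatcherAT2002, Prop. 3.10] -/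
theorem smul_cupPowTwo_map_mem_divisorClassesSpan (Θ : complexBetti 𝒳 2) (s : ComplexPoints S)
    (hΘQ : IsRationalClass (complexBetti.map (fiberι f s) 2 Θ)) (hΘ : IsOfHodgeType n (fiberOver f s) 2 1 1 (complexBetti.map (fiberι f s) 2 Θ))
    (c : ℂ) (m : ℕ) :
    complexBetti.map (fiberι f s) (2 * m) (c • cupPowTwo Θ m) ∈ divisorClassesSpan (fiberOver f s) n m := by
  rw [map_smul]
  refine Submodule.smul_mem _ _ (Submodule.subset_span ?_)
  have h : complexBetti.map (fiberι f s) (2 * m) (cupPowTwo Θ m) = cupPowTwo (complexBetti.map (fiberι f s) 2 Θ) m :=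
    map_cupPowTwo _ Θ m
  rw [h]
  exact cupPowTwo_mem_divisorMonomials hΘQ hΘ m

/-! ## §2 The pin: a global class Lefschetz at the Picard-rank-one fibre is `c · Θᵖ` on EVERY fibre -/

/-- **THE PIN.** `f : 𝒳 ⟶ S` a smooth projective family over a smooth irreducible base, `Θ ∈ H²(𝒳(ℂ); ℂ)`, `s♯` a complex point of `S` at
which every rational `(1,1)`-class of `H²(𝒳_{s♯})` lies on `ℂ · Θ|_{s♯}`. Then every GLOBAL class `Z ∈ H^{2p}(𝒳(ℂ); ℂ)` whose restriction to
`𝒳_{s♯}` is a Lefschetz class (`∈ Dᵖ ⊗ ℂ`) satisfies `Z|_s = c · (Θᵖ)|_s` for one scalar `c` and EVERY complex point `s` of `S`: at `s♯` by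
§1, and `Z − c·Θᵖ` is a global class vanishing on one fibre, hence on all (identity principle for flat sections; `S(ℂ)` is connected).
[cite: vanGeemen1994HodgeAV, Thm. 4.11 and §2.4] [cite: DeligneHodgeII1971, Cor. 4.1.2 (proof)] [cite: VoisinHodgeII2003, Lemma 4.17]
[cite: SGA1, Exp. XII Prop. 2.4] -/
theorem exists_eq_smul_cupPowTwo_forall_of_mem_divisorClassesSpan_at (hf : IsSmoothProjectiveFamily f n)
    (hirr : IrreducibleSpace S.left) (hsm : AlgebraicGeometry.Smooth S.hom) (Θ : complexBetti 𝒳 2) {s₀ : ComplexPoints S}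
    (hpic : ∀ b : complexBetti (fiberOver f s₀) 2, IsRationalClass b → IsOfHodgeType n (fiberOver f s₀) 2 1 1 b →
      b ∈ ℂ ∙ complexBetti.map (fiberι f s₀) 2 Θ)
    {p : ℕ} {Z : complexBetti 𝒳 (2 * p)} (hZ : complexBetti.map (fiberι f s₀) (2 * p) Z ∈ divisorClassesSpan (fiberOver f s₀) n p) :
    ∃ c : ℂ, ∀ s : ComplexPoints S,
      complexBetti.map (fiberι f s) (2 * p) Z = c • complexBetti.map (fiberι f s) (2 * p) (cupPowTwo Θ p) := by
  have h1 : complexBetti.map (fiberι f s₀) (2 * p) (cupPowTwo Θ p) = cupPowTwo (complexBetti.map (fiberι f s₀) 2 Θ) p :=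
    map_cupPowTwo _ Θ p
  obtain ⟨c, hc⟩ := Submodule.mem_span_singleton.1 (divisorClassesSpan_le_span_cupPowTwo hpic p hZ)
  refine ⟨c, fun s ↦ ?_⟩
  haveI := hirr
  haveI := hsm
  haveI : ConnectedSpace (ComplexPoints S) := connectedSpace_complexPoints_of_irreducibleSpace S
  have h0 : complexBetti.map (fiberι f s₀) (2 * p) (Z - c • cupPowTwo Θ p) = 0 := by
    rw [map_sub, map_smul, h1, hc, sub_self]
  have h := complexBetti_map_fiberι_eq_zero_of_eq_zero_at f hf h0 s
  rwa [map_sub, map_smul, sub_eq_zero] at h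

/-- **A fibrewise-Lefschetz global class is pinned**: if `Z|_s ∈ Dᵖ(𝒳_s) ⊗ ℂ` for EVERY `s` (the K-SR♭∃ correction) then `Z ≡ c · Θᵖ` on every
fibre, the scalar being read at the Picard-rank-one fibre. [cite: vanGeemen1994HodgeAV, Thm. 4.11 and §2.4] [cite: DeligneHodgeII1971, Cor. 4.1.2 (proof)] -/
theorem exists_eq_smul_cupPowTwo_forall_of_forall_mem_divisorClassesSpan (hf : IsSmoothProjectiveFamily f n)
    (hirr : IrreducibleSpace S.left) (hsm : AlgebraicGeometry.Smooth S.hom) (Θ : complexBetti 𝒳 2) {s₀ : ComplexPoints S}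
    (hpic : ∀ b : complexBetti (fiberOver f s₀) 2, IsRationalClass b → IsOfHodgeType n (fiberOver f s₀) 2 1 1 b →
      b ∈ ℂ ∙ complexBetti.map (fiberι f s₀) 2 Θ)
    {p : ℕ} {Z : complexBetti 𝒳 (2 * p)} (hZ : ∀ s : ComplexPoints S, complexBetti.map (fiberι f s) (2 * p) Z ∈ divisorClassesSpan (fiberOver f s) n p) :
    ∃ c : ℂ, ∀ s : ComplexPoints S,
      complexBetti.map (fiberι f s) (2 * p) Z = c • complexBetti.map (fiberι f s) (2 * p) (cupPowTwo Θ p) :=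
  exists_eq_smul_cupPowTwo_forall_of_mem_divisorClassesSpan_at hf hirr hsm Θ hpic (hZ s₀)

/-! ## §3 The pinned form of the K-SR♭∃ datum (every door) -/

/-- **A K-SR♭∃ datum is pinned.** In the data of the conclusion of `AdmissibleRepresentativesLefAt 𝒪` (`V_p = a·W + Z`, `Z` Lefschetz on every
fibre, `κ_p = V_p|_{s₁}`) on a pencil with a Picard-rank-one fibre `s₀` (Hodge form, w.r.t. `Θ|_{s₀}`): `V_p|_s = a·W|_s + c·(Θᵖ)|_s` at EVERY
fibre and `κ_p = a·W|_{s₁} + c·(Θᵖ)|_{s₁}` — the Lefschetz slack is the scalar `c`. [cite: Bloch1972Semiregularity, Remark (7.5)]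
[cite: vanGeemen1994HodgeAV, Thm. 4.11 and §2.4] [cite: DeligneHodgeII1971, Cor. 4.1.2 (proof)] -/
theorem pinned_of_lefAtDatum (hf : IsSmoothProjectiveFamily f n) (hirr : IrreducibleSpace S.left) (hsm : AlgebraicGeometry.Smooth S.hom)
    (Θ : complexBetti 𝒳 2) {s₀ : ComplexPoints S}
    (hpic : ∀ b : complexBetti (fiberOver f s₀) 2, IsRationalClass b → IsOfHodgeType n (fiberOver f s₀) 2 1 1 b →
      b ∈ ℂ ∙ complexBetti.map (fiberι f s₀) 2 Θ)
    {p : ℕ} (W Z Vp : complexBetti 𝒳 (2 * p)) (a : ℂ) {s₁ : ComplexPoints S} (κp : complexBetti (fiberOver f s₁) (2 * p))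
    (hVp : Vp = a • W + Z) (hκ : κp = complexBetti.map (fiberι f s₁) (2 * p) Vp)
    (hZ : ∀ s : ComplexPoints S, complexBetti.map (fiberι f s) (2 * p) Z ∈ divisorClassesSpan (fiberOver f s) n p) :
    ∃ c : ℂ, (∀ s : ComplexPoints S, complexBetti.map (fiberι f s) (2 * p) Vp =
        a • complexBetti.map (fiberι f s) (2 * p) W + c • complexBetti.map (fiberι f s) (2 * p) (cupPowTwo Θ p)) ∧
      κp = a • complexBetti.map (fiberι f s₁) (2 * p) W + c • complexBetti.map (fiberι f s₁) (2 * p) (cupPowTwo Θ p) := by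
  obtain ⟨c, hc⟩ := exists_eq_smul_cupPowTwo_forall_of_forall_mem_divisorClassesSpan hf hirr hsm Θ hpic hZ
  have hV : ∀ s : ComplexPoints S, complexBetti.map (fiberι f s) (2 * p) Vp =
      a • complexBetti.map (fiberι f s) (2 * p) W + c • complexBetti.map (fiberι f s) (2 * p) (cupPowTwo Θ p) := fun s ↦ by
    rw [hVp, map_add, map_smul, hc s]
  exact ⟨c, hV, by rw [hκ, hV s₁]⟩

/-- **K-SR♭∃ on a pencil with a Picard-rank-one fibre delivers a PINNED datum** (door-generic): some fibre `s₁`, degrees `I ∋ p`, an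
`𝒪`-admissible `κ`, fibrewise-Hodge global `V_q` restricting to `κ_q` at `s₁`, `a ≠ 0` and a SCALAR `c` with `κ_p = a·W|_{s₁} + c·(Θᵖ)|_{s₁}` and
`V_p ≡ a·W + c·Θᵖ` on every fibre. [cite: Bloch1972Semiregularity, Remark (7.5)] [cite: vanGeemen1994HodgeAV, Thm. 4.11 and §2.4]
[cite: DeligneHodgeII1971, Cor. 4.1.2 (proof)] -/
theorem exists_pinned_of_admissibleRepresentativesLefAt {𝒪 : ObjClass} (h : AdmissibleRepresentativesLefAt 𝒪)
    (hf : IsSmoothProjectiveFamily f n) (h𝒳 : IsQuasiProjectiveOver 𝒳) (hirr : IrreducibleSpace S.left) (haff : IsAffine S.left)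
    (hsm : AlgebraicGeometry.Smooth S.hom) (hdim : topologicalKrullDim S.left = 1)
    (habel : ∀ s : ComplexPoints S, ∃ A' : AbelianVariety ℂ, A'.dim = n ∧ Nonempty (A'.X ≅ fiberOver f s))
    (he : ∃ e : S ⟶ 𝒳, e ≫ f = 𝟙 S) (p : ℕ) (W : complexBetti 𝒳 (2 * p))
    (hW : ∀ s : ComplexPoints S, IsRationalClass (complexBetti.map (fiberι f s) (2 * p) W) ∧
      IsOfHodgeType n (fiberOver f s) (2 * p) p p (complexBetti.map (fiberι f s) (2 * p) W))
    (s' : ComplexPoints S) (hs' : complexBetti.map (fiberι f s') (2 * p) W ∈ algebraicClasses (fiberOver f s') p)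
    (Θ : complexBetti 𝒳 2) {s₀ : ComplexPoints S}
    (hpic : ∀ b : complexBetti (fiberOver f s₀) 2, IsRationalClass b → IsOfHodgeType n (fiberOver f s₀) 2 1 1 b →
      b ∈ ℂ ∙ complexBetti.map (fiberι f s₀) 2 Θ) :
    ∃ (s₁ : ComplexPoints S) (I : Finset ℕ) (κ : (q : ℕ) → complexBetti (fiberOver f s₁) (2 * q))
      (V : (q : ℕ) → complexBetti 𝒳 (2 * q)) (a c : ℂ),
      p ∈ I ∧ 𝒪 n (fiberOver f s₁) I κ ∧ a ≠ 0 ∧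
      κ p = a • complexBetti.map (fiberι f s₁) (2 * p) W + c • complexBetti.map (fiberι f s₁) (2 * p) (cupPowTwo Θ p) ∧
      (∀ s : ComplexPoints S, complexBetti.map (fiberι f s) (2 * p) (V p) =
        a • complexBetti.map (fiberι f s) (2 * p) W + c • complexBetti.map (fiberι f s) (2 * p) (cupPowTwo Θ p)) ∧
      (∀ q ∈ I, κ q = complexBetti.map (fiberι f s₁) (2 * q) (V q)) ∧
      (∀ q ∈ I, ∀ s : ComplexPoints S, IsOfHodgeType n (fiberOver f s) (2 * q) q q (complexBetti.map (fiberι f s) (2 * q) (V q))) := by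
  obtain ⟨s₁, I, κ, V, a, Z, hpI, hκ, ha, hZ, hVp, hκV, hVH⟩ := h f hf h𝒳 hirr haff hsm hdim habel he p W hW s' hs'
  obtain ⟨c, hV, hκp⟩ := pinned_of_lefAtDatum hf hirr hsm Θ hpic W Z (V p) a (κ p) hVp (hκV p hpI) fun s ↦ (hZ s).2
  exact ⟨s₁, I, κ, V, a, c, hpI, hκ, ha, hκp, hV, hκV, hVH⟩

/-- **The exceptional regime on a pencil with a Picard-rank-one fibre delivers a PINNED datum** (same, for stub 2's statement).
[cite: Bloch1972Semiregularity, Remark (7.5)] [cite: vanGeemen1994HodgeAV, Thm. 4.11 and §2.4] -/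
theorem exists_pinned_of_lefAtExceptionalRegime {𝒪 : ObjClass} (h : LefAtExceptionalRegime 𝒪)
    (hf : IsSmoothProjectiveFamily f n) (h𝒳 : IsQuasiProjectiveOver 𝒳) (hirr : IrreducibleSpace S.left) (haff : IsAffine S.left)
    (hsm : AlgebraicGeometry.Smooth S.hom) (hdim : topologicalKrullDim S.left = 1)
    (habel : ∀ s : ComplexPoints S, ∃ A' : AbelianVariety ℂ, A'.dim = n ∧ Nonempty (A'.X ≅ fiberOver f s))
    (he : ∃ e : S ⟶ 𝒳, e ≫ f = 𝟙 S) (p : ℕ) (W : complexBetti 𝒳 (2 * p))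
    (hW : ∀ s : ComplexPoints S, IsRationalClass (complexBetti.map (fiberι f s) (2 * p) W) ∧
      IsOfHodgeType n (fiberOver f s) (2 * p) p p (complexBetti.map (fiberι f s) (2 * p) W))
    (s' : ComplexPoints S) (hs' : complexBetti.map (fiberι f s') (2 * p) W ∈ algebraicClasses (fiberOver f s') p)
    (hexc : ¬ ∀ s : ComplexPoints S,
      complexBetti.map (fiberι f s) (2 * p) W ∈ algebraicClasses (fiberOver f s) p ∧
      complexBetti.map (fiberι f s) (2 * p) W ∈ divisorClassesSpan (fiberOver f s) n p)
    (Θ : complexBetti 𝒳 2) {s₀ : ComplexPoints S}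
    (hpic : ∀ b : complexBetti (fiberOver f s₀) 2, IsRationalClass b → IsOfHodgeType n (fiberOver f s₀) 2 1 1 b →
      b ∈ ℂ ∙ complexBetti.map (fiberι f s₀) 2 Θ) :
    ∃ (s₁ : ComplexPoints S) (I : Finset ℕ) (κ : (q : ℕ) → complexBetti (fiberOver f s₁) (2 * q))
      (V : (q : ℕ) → complexBetti 𝒳 (2 * q)) (a c : ℂ),
      p ∈ I ∧ 𝒪 n (fiberOver f s₁) I κ ∧ a ≠ 0 ∧
      κ p = a • complexBetti.map (fiberι f s₁) (2 * p) W + c • complexBetti.map (fiberι f s₁) (2 * p) (cupPowTwo Θ p) ∧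
      (∀ s : ComplexPoints S, complexBetti.map (fiberι f s) (2 * p) (V p) =
        a • complexBetti.map (fiberι f s) (2 * p) W + c • complexBetti.map (fiberι f s) (2 * p) (cupPowTwo Θ p)) ∧
      (∀ q ∈ I, κ q = complexBetti.map (fiberι f s₁) (2 * q) (V q)) ∧
      (∀ q ∈ I, ∀ s : ComplexPoints S, IsOfHodgeType n (fiberOver f s) (2 * q) q q (complexBetti.map (fiberι f s) (2 * q) (V q))) := by
  obtain ⟨s₁, I, κ, V, a, Z, hpI, hκ, ha, hZ, hVp, hκV, hVH⟩ := h f hf h𝒳 hirr haff hsm hdim habel he p W hW s' hs' hexc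
  obtain ⟨c, hV, hκp⟩ := pinned_of_lefAtDatum hf hirr hsm Θ hpic W Z (V p) a (κ p) hVp (hκV p hpI) fun s ↦ (hZ s).2
  exact ⟨s₁, I, κ, V, a, c, hpI, hκ, ha, hκp, hV, hκV, hVH⟩

/-! ## §4 Conversely: a pinned datum is a K-SR♭∃ datum -/

/-- **A pinned datum is a K-SR♭∃ datum** when `Θ|_s` is rational of type `(1,1)` and `(Θᵖ)|_s` is algebraic on every fibre (e.g. `Θ` a
polarization class): take `Z := c · Θᵖ`. So on pencils with a Picard-rank-one fibre, K-SR♭∃ for the door `𝒪` is EXACTLY the design problem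
«an `𝒪`-admissible datum at some fibre with `κ_p = a·W| + c·θᵖ`, `a ≠ 0`» (§3 + this). [cite: Bloch1972Semiregularity, Remark (7.5)]
[cite: vanGeemen1994HodgeAV, §2.4] -/
theorem lefAtDatum_of_pinned {𝒪 : ObjClass} (Θ : complexBetti 𝒳 2)
    (hΘQ : ∀ s : ComplexPoints S, IsRationalClass (complexBetti.map (fiberι f s) 2 Θ))
    (hΘH : ∀ s : ComplexPoints S, IsOfHodgeType n (fiberOver f s) 2 1 1 (complexBetti.map (fiberι f s) 2 Θ))
    {p : ℕ} (hΘalg : ∀ s : ComplexPoints S, complexBetti.map (fiberι f s) (2 * p) (cupPowTwo Θ p) ∈ algebraicClasses (fiberOver f s) p)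
    (W : complexBetti 𝒳 (2 * p)) {s₁ : ComplexPoints S} {I : Finset ℕ} {κ : (q : ℕ) → complexBetti (fiberOver f s₁) (2 * q)}
    {V : (q : ℕ) → complexBetti 𝒳 (2 * q)} {a c : ℂ}
    (hpI : p ∈ I) (hκ : 𝒪 n (fiberOver f s₁) I κ) (ha : a ≠ 0)
    (hV : V p = a • W + c • cupPowTwo Θ p)
    (hκV : ∀ q ∈ I, κ q = complexBetti.map (fiberι f s₁) (2 * q) (V q))
    (hVH : ∀ q ∈ I, ∀ s : ComplexPoints S, IsOfHodgeType n (fiberOver f s) (2 * q) q q (complexBetti.map (fiberι f s) (2 * q) (V q))) :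
    ∃ (s₁ : ComplexPoints S) (I : Finset ℕ) (κ : (q : ℕ) → complexBetti (fiberOver f s₁) (2 * q))
      (V : (q : ℕ) → complexBetti 𝒳 (2 * q)) (a : ℂ) (Z : complexBetti 𝒳 (2 * p)),
      p ∈ I ∧ 𝒪 n (fiberOver f s₁) I κ ∧ a ≠ 0 ∧
      (∀ s : ComplexPoints S,
        complexBetti.map (fiberι f s) (2 * p) Z ∈ algebraicClasses (fiberOver f s) p ∧
        complexBetti.map (fiberι f s) (2 * p) Z ∈ divisorClassesSpan (fiberOver f s) n p) ∧
      V p = a • W + Z ∧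
      (∀ q ∈ I, κ q = complexBetti.map (fiberι f s₁) (2 * q) (V q)) ∧
      (∀ q ∈ I, ∀ s : ComplexPoints S, IsOfHodgeType n (fiberOver f s) (2 * q) q q (complexBetti.map (fiberι f s) (2 * q) (V q))) := by
  refine ⟨s₁, I, κ, V, a, c • cupPowTwo Θ p, hpI, hκ, ha, fun s ↦ ⟨?_, ?_⟩, hV, hκV, hVH⟩
  · rw [map_smul]
    exact Submodule.smul_mem _ _ (hΘalg s)
  · exact smul_cupPowTwo_map_mem_divisorClassesSpan Θ s (hΘQ s) (hΘH s) c p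

/-! ## §5 The exceptional hypothesis read at the Picard-rank-one fibre; the pinned BC5 rung (ab-andre-2, gen 53, append) -/

/-- **At a Picard-rank-one fibre, «`W|` off the line `ℂ·(Θᵖ)|`» IS the exceptional-regime hypothesis**: if `W|_{s₀} ∉ ℂ · (Θᵖ)|_{s₀}` then
`W` is not an algebraic Lefschetz class on every fibre (it is not Lefschetz at `s₀`, §1). On a Weil-type pencil: `W|_{s₀}` a Weil class of a
very general member. [cite: vanGeemen1994HodgeAV, Thm. 4.11 and §2.4] -/
theorem not_forall_lefschetz_of_not_mem_span_at (Θ : complexBetti 𝒳 2) {s₀ : ComplexPoints S}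
    (hpic : ∀ b : complexBetti (fiberOver f s₀) 2, IsRationalClass b → IsOfHodgeType n (fiberOver f s₀) 2 1 1 b →
      b ∈ ℂ ∙ complexBetti.map (fiberι f s₀) 2 Θ)
    {p : ℕ} {W : complexBetti 𝒳 (2 * p)}
    (hW : complexBetti.map (fiberι f s₀) (2 * p) W ∉ ℂ ∙ complexBetti.map (fiberι f s₀) (2 * p) (cupPowTwo Θ p)) :
    ¬ ∀ s : ComplexPoints S,
      complexBetti.map (fiberι f s) (2 * p) W ∈ algebraicClasses (fiberOver f s) p ∧
      complexBetti.map (fiberι f s) (2 * p) W ∈ divisorClassesSpan (fiberOver f s) n p := by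
  intro h
  apply hW
  have h1 : complexBetti.map (fiberι f s₀) (2 * p) (cupPowTwo Θ p) = cupPowTwo (complexBetti.map (fiberι f s₀) 2 Θ) p :=
    map_cupPowTwo _ Θ p
  rw [h1]
  exact divisorClassesSpan_le_span_cupPowTwo hpic p (h s₀).2

/-- **The BC5 rung delivers a PINNED datum at `(n, p) = (6, 3)`**: on a sixfold pencil with a Picard-rank-one fibre (Hodge form w.r.t. `Θ|`),
`LefAtExceptionalRegimeSixfoldMiddle 𝒪` gives some fibre `s₁` and an `𝒪`-admissible datum with `κ₃ = a·W|_{s₁} + c·(Θ³)|_{s₁}`, `a ≠ 0` —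
the design problem of the separating habitat (non-split Weil-type sixfold pencils, generic NS rank 1), every door.
[cite: Bloch1972Semiregularity, Remark (7.5)] [cite: vanGeemen1994HodgeAV, Thm. 4.11 and §2.4] [cite: DeligneHodgeII1971, Cor. 4.1.2 (proof)] -/
theorem exists_pinned_of_lefAtExceptionalRegimeSixfoldMiddle {𝒪 : ObjClass} (h : LefAtExceptionalRegimeSixfoldMiddle 𝒪)
    (hf : IsSmoothProjectiveFamily f 6) (h𝒳 : IsQuasiProjectiveOver 𝒳) (hirr : IrreducibleSpace S.left) (haff : IsAffine S.left)
    (hsm : AlgebraicGeometry.Smooth S.hom) (hdim : topologicalKrullDim S.left = 1)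
    (habel : ∀ s : ComplexPoints S, ∃ A' : AbelianVariety ℂ, A'.dim = 6 ∧ Nonempty (A'.X ≅ fiberOver f s))
    (he : ∃ e : S ⟶ 𝒳, e ≫ f = 𝟙 S) (W : complexBetti 𝒳 (2 * 3))
    (hW : ∀ s : ComplexPoints S, IsRationalClass (complexBetti.map (fiberι f s) (2 * 3) W) ∧
      IsOfHodgeType 6 (fiberOver f s) (2 * 3) 3 3 (complexBetti.map (fiberι f s) (2 * 3) W))
    (s' : ComplexPoints S) (hs' : complexBetti.map (fiberι f s') (2 * 3) W ∈ algebraicClasses (fiberOver f s') 3)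
    (hexc : ¬ ∀ s : ComplexPoints S,
      complexBetti.map (fiberι f s) (2 * 3) W ∈ algebraicClasses (fiberOver f s) 3 ∧
      complexBetti.map (fiberι f s) (2 * 3) W ∈ divisorClassesSpan (fiberOver f s) 6 3)
    (Θ : complexBetti 𝒳 2) {s₀ : ComplexPoints S}
    (hpic : ∀ b : complexBetti (fiberOver f s₀) 2, IsRationalClass b → IsOfHodgeType 6 (fiberOver f s₀) 2 1 1 b →
      b ∈ ℂ ∙ complexBetti.map (fiberι f s₀) 2 Θ) :
    ∃ (s₁ : ComplexPoints S) (I : Finset ℕ) (κ : (q : ℕ) → complexBetti (fiberOver f s₁) (2 * q))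
      (V : (q : ℕ) → complexBetti 𝒳 (2 * q)) (a c : ℂ),
      3 ∈ I ∧ 𝒪 6 (fiberOver f s₁) I κ ∧ a ≠ 0 ∧
      κ 3 = a • complexBetti.map (fiberι f s₁) (2 * 3) W + c • complexBetti.map (fiberι f s₁) (2 * 3) (cupPowTwo Θ 3) ∧
      (∀ s : ComplexPoints S, complexBetti.map (fiberι f s) (2 * 3) (V 3) =
        a • complexBetti.map (fiberι f s) (2 * 3) W + c • complexBetti.map (fiberι f s) (2 * 3) (cupPowTwo Θ 3)) ∧
      (∀ q ∈ I, κ q = complexBetti.map (fiberι f s₁) (2 * q) (V q)) ∧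
      (∀ q ∈ I, ∀ s : ComplexPoints S, IsOfHodgeType 6 (fiberOver f s) (2 * q) q q (complexBetti.map (fiberι f s) (2 * q) (V q))) := by
  obtain ⟨s₁, I, κ, V, a, Z, hpI, hκ, ha, hZ, hVp, hκV, hVH⟩ := h f hf h𝒳 hirr haff hsm hdim habel he W hW s' hs' hexc
  obtain ⟨c, hV, hκp⟩ := pinned_of_lefAtDatum hf hirr hsm Θ hpic W Z (V 3) a (κ 3) hVp (hκV 3 hpI) fun s ↦ (hZ s).2
  exact ⟨s₁, I, κ, V, a, c, hpI, hκ, ha, hκp, hV, hκV, hVH⟩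

end Summit.HodgeConjecture.HodgeConjecture.Ring2.SemiregularRepresentatives

end
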